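import Summits.QuantumFields.GaugeBoot.PlanarRelaxationResolved
import HarnessLib

/-!
# Orientation-resolved planar certificates are EXACTLY sound for `U(N)` at every `N`; what large `N` buys in Kazakov–Zheng's SDP is one identification row (gauge-boot, large-`N` supplement 16)

HONEST FRAMING (cell `pub-gaugeboot`, page 1 of every file): the venture produces certified bounds
on lattice expectations at stated coupling, gauge group, dimension and torus size; NOT a mass gap,
NOT a continuum limit, NOT a string tension; NOT large `N` unless marked CONDITIONAL; NOT
Yang–Mills-summit-bearing (barriers `FixedCouplingUltralocality`, `PerturbativeInvisibility`).
This file says what an ORIENTATION-RESOLVED planar certificate proves about the finite-`N` theory;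
it certifies no number and no planar certificate of the cell exists in the tree.

## The object

Supplement 4 (`PlanarCertificateSoundnessZd`) fixed the format of a planar (Kazakov–Zheng) certificate
`P` — rows (planar loop equations with multipliers `y_r`), rank-one Gram blocks, rank-one relaxation
multipliers `(m₀, m)` on the loops `ℓ_A` of the block `[[1, Wᵀ], [W, Q]]`, identification rows `lin_e`
with multipliers `z_e` — and its validity `bound − obj(W) = rhs(W, Q)`, where the relaxation term is
wired as KZ wire it at `N = ∞`: `Σ_{A,B} m_A m_B Q(ℓ_A, ℓ_B)`.  Here the SAME data is declared valid in
the ORIENTATION-RESOLVED wiring (`PlanarCertificate.IsValidResolved`): the relaxation term reads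
`Σ_{A,B} m_A m_B Q(ℓ_A, ℓ_B⁻¹)` (`shorTermResolved`).  At `N = ∞` the two wirings agree (real `W`,
`Q = W Wᵀ`, `W[C⁻¹] = W[C]`); a checker verifies either identity by the same linear algebra.

## The theorems

* ★ `isValid_withOrientationRow_iff` — THE DICTIONARY: `P` is resolved-valid iff the KZ-wired
  certificate `P.withOrientationRow` — `P` plus ONE extra identification row, the aggregated
  SEPARATE-ORIENTATION identification `Σ_s Σ_{A,B} m_{sA} m_{sB} (Q(ℓ_A, ℓ_B⁻¹) − Q(ℓ_A, ℓ_B))` with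
  multiplier `1` — is valid in the sense of supplement 4.  On a state's data that row evaluates to
  `2 Σ_s E(Σ_A m_{sA} Im t_{ℓ_A})²` (`orientationRow_loopQ_eq`): supplement 4's relaxation defect IS the
  finite-`N` violation of this one identification row, nothing else.
* ★★★ `obj_loopW_le_uN_resolved` — **`U(N)`, EVERY `N`, EVERY real coupling, EVERY probability
  Haar-shift state on `ℤ^d` (DLR states `…_of_mem_ymGibbsMeasures_resolved`, torus thermodynamic limit
  points `…_of_mem_infiniteVolumeLimitPoints_resolved`, Class-B states) satisfying the identification
  rows: `obj(W_μ) ≤ bound` — NO DEFECT, NO CONDITION.**  An orientation-resolved planar certificate is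
  an honest finite-`N` certificate for `U(N)` lattice Yang–Mills.
* ★★★ `obj_loopW_le_suN_resolved` — `SU(N)`: `obj ≤ bound + Σ_r |y_r| ε_r` with ONLY the row defects
  `ε_r = length(w_r)/N² + |βt| Σ_{ν,ε} |Γ(w_r, P̃_{ν,ε})|` of supplement 3 (themselves the violations of
  the planar rows' own orientation identifications `Q(w, P̃) ≡ Q(w, P̃⁻¹)` and of dropping the `1/N²`
  terms); DLR / limit-point corollaries.
* `obj_le_of_defects_resolved` — the abstract transfer with defective rows and identification rows
  (for class-indexed certificates, supplement 7).
* Sequel `PlanarCertificateResolvedTorus`: the cell's torus objects at every `(N, β, L)` (exact for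
  `U(N)`), and the `1/N²` law with the row constant only (given SZZ).

## Meaning (say it this way)

"What large-`N` factorisation buys in Kazakov–Zheng's planar SDP is not the relaxation
`[[1, Wᵀ], [W, Q]] ⪰ 0` — wired through the reversed second loop that block is a finite-`N` theorem
for every state — but the IDENTIFICATIONS of pair variables under symmetries applied to ONE member of
a pair: orientation reversal (this file: cost `2 E(Σ m Im t)²`) and translation (supplement 7: cost a
covariance).  Jointly applied symmetries, the planar `U(N)` rows, Gram and reflection blocks are exact
at every `N`."  NOT claimed: that any planar certificate of the cell exists; anything about `SU(∞)`;
that resolving orientations is free at `N = ∞` numerically (it doubles the block's index set).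
[folklore] conic bookkeeping; Kazakov–Zheng arXiv:2203.11360 §3, arXiv:2404.16925 §3.1.
-/

noncomputable section

open MeasureTheory
open scoped BigOperators
open Literature.Probability.LatticeModels (Site)
open Literature.MathematicalPhysics.QuantumLattice
open Literature.MathematicalPhysics.QuantumFieldTheory (GaugeConfig wilsonMeasure isProbabilityMeasure_wilsonMeasure)

namespace Summit.QuantumFields.GaugeBoot

variable {d N : ℕ}

namespace PlanarCertificate

variable (P : PlanarCertificate d)

/-! ## The orientation-resolved wiring of a planar certificate -/

/-- **The relaxation pairing of factor `s`, ORIENTATION-RESOLVED**: the block entry `(A, B)` reads the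
pair variable of `ℓ_A` and the REVERSED loop `ℓ_B⁻¹`:
`m₀² + 2 m₀ Σ_A m_A W(ℓ_A) + Σ_{A,B} m_A m_B Q(ℓ_A, ℓ_B⁻¹)`. [folklore] -/
def shorTermResolved (s : Fin P.nS) (W : Word d → ℝ) (Q : Word d → Word d → ℝ) : ℝ :=
  shorPairing (P.shorConst s) (P.shorVec s) (fun A => W (P.shorLoop A)) (fun A B => Q (P.shorLoop A) (P.shorLoop B).reverse)

/-- The right-hand side of the certificate identity in the orientation-resolved wiring. [folklore] -/
def rhsResolved (W : Word d → ℝ) (Q : Word d → Word d → ℝ) : ℝ :=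
  (∑ r, P.rowMult r * planarRow P.βt (P.rowAxis r) (P.rowWord r) W Q) +
    (∑ j, gramPairing (P.gramWord j) (P.gramVec j) W) +
    (∑ s, P.shorTermResolved s W Q) +
    ∑ e, P.linMult e * P.lin e W Q

/-- **Resolved validity**: `bound − obj(W) = rhsResolved(W, Q)` for ALL planar data (an identity of
affine functionals — what a certificate checker verifies; Kazakov–Zheng's dual identity with the
relaxation block read through reversed second loops). [cite: KazakovZheng2023, §3.2] -/
def IsValidResolved : Prop := ∀ (W : Word d → ℝ) (Q : Word d → Word d → ℝ), P.bound - P.obj W = P.rhsResolved W Q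

/-- **The aggregated separate-orientation identification functional** of the certificate:
`Σ_s Σ_{A,B} m_{sA} m_{sB} (Q(ℓ_A, ℓ_B⁻¹) − Q(ℓ_A, ℓ_B))` — zero on factorised planar data with
`W[C⁻¹] = W[C]`, NOT zero at finite `N`. [folklore] -/
def orientationRow (Q : Word d → Word d → ℝ) : ℝ :=
  ∑ s, ∑ A, ∑ B, P.shorVec s A * P.shorVec s B * (Q (P.shorLoop A) (P.shorLoop B).reverse - Q (P.shorLoop A) (P.shorLoop B))

/-- The resolved and the planar wiring of one relaxation factor differ by its orientation rows. [folklore] -/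
theorem shorTermResolved_sub_shorTerm (s : Fin P.nS) (W : Word d → ℝ) (Q : Word d → Word d → ℝ) :
    P.shorTermResolved s W Q - P.shorTerm s W Q =
      ∑ A, ∑ B, P.shorVec s A * P.shorVec s B * (Q (P.shorLoop A) (P.shorLoop B).reverse - Q (P.shorLoop A) (P.shorLoop B)) :=
  shorPairing_sub_shorPairing _ _ _ _ _

/-- `rhsResolved − rhs = orientationRow`. [folklore] -/
theorem rhsResolved_sub_rhs (W : Word d → ℝ) (Q : Word d → Word d → ℝ) :
    P.rhsResolved W Q - P.rhs W Q = P.orientationRow Q := by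
  rw [rhsResolved, rhs, orientationRow]
  have h : (∑ s, P.shorTermResolved s W Q) - ∑ s, P.shorTerm s W Q =
      ∑ s, ∑ A, ∑ B, P.shorVec s A * P.shorVec s B * (Q (P.shorLoop A) (P.shorLoop B).reverse - Q (P.shorLoop A) (P.shorLoop B)) := by
    rw [← Finset.sum_sub_distrib]
    exact Finset.sum_congr rfl fun s _ => P.shorTermResolved_sub_shorTerm s W Q
  linarith

/-- **The KZ-wired certificate `P` plus ONE identification row**: the orientation row with multiplier `1`,
prepended to the identification rows. [folklore] -/
def withOrientationRow : PlanarCertificate d :=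
  { P with
    nE := P.nE + 1
    lin := Fin.cons (fun _ Q => P.orientationRow Q) P.lin
    linMult := Fin.cons 1 P.linMult }

/-- The right-hand side of `P.withOrientationRow` is `rhs + orientationRow = rhsResolved`. [folklore] -/
theorem rhs_withOrientationRow (W : Word d → ℝ) (Q : Word d → Word d → ℝ) :
    P.withOrientationRow.rhs W Q = P.rhsResolved W Q := by
  have h := P.rhsResolved_sub_rhs W Q
  have hE : ∑ e : Fin (P.nE + 1), (Fin.cons (1 : ℝ) P.linMult : Fin (P.nE + 1) → ℝ) e *
      (Fin.cons (fun (_ : Word d → ℝ) (Q' : Word d → Word d → ℝ) => P.orientationRow Q') P.lin :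
        Fin (P.nE + 1) → (Word d → ℝ) → (Word d → Word d → ℝ) → ℝ) e W Q =
      P.orientationRow Q + ∑ e, P.linMult e * P.lin e W Q := by
    rw [Fin.sum_univ_succ]
    simp only [Fin.cons_zero, Fin.cons_succ, one_mul]
  have hrest : P.withOrientationRow.rhs W Q =
      (∑ r, P.rowMult r * planarRow P.βt (P.rowAxis r) (P.rowWord r) W Q) +
        (∑ j, gramPairing (P.gramWord j) (P.gramVec j) W) + (∑ s, P.shorTerm s W Q) +
        ∑ e : Fin (P.nE + 1), (Fin.cons (1 : ℝ) P.linMult : Fin (P.nE + 1) → ℝ) e *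
          (Fin.cons (fun (_ : Word d → ℝ) (Q' : Word d → Word d → ℝ) => P.orientationRow Q') P.lin :
            Fin (P.nE + 1) → (Word d → ℝ) → (Word d → Word d → ℝ) → ℝ) e W Q := rfl
  rw [hrest, hE]
  rw [rhs] at h
  linarith

/-- ★ **THE DICTIONARY: a planar certificate is resolved-valid iff the KZ-wired certificate with the one
extra orientation-identification row is valid** (supplement 4's sense).  So the large-`N` content of the
relaxation block of a KZ certificate is exactly this one identification row. [folklore] -/
theorem isValid_withOrientationRow_iff : P.withOrientationRow.IsValid ↔ P.IsValidResolved := by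
  simp only [IsValid, IsValidResolved, rhs_withOrientationRow]
  exact Iff.rfl

/-! ## Abstract soundness of the resolved wiring -/

/-- **Planar soundness of the resolved wiring (`N = ∞`, for the record)**: on data satisfying the rows,
the identification rows, Gram positivity and the relaxation read through reversed second loops, a
resolved-valid certificate gives `obj ≤ bound`. [folklore] -/
theorem obj_le_bound_of_feasible_resolved (hP : P.IsValidResolved) (W : Word d → ℝ) (Q : Word d → Word d → ℝ)
    (hrow : ∀ r, planarRow P.βt (P.rowAxis r) (P.rowWord r) W Q = 0)
    (hgram : ∀ j, 0 ≤ gramPairing (P.gramWord j) (P.gramVec j) W)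
    (hshor : IsRelaxationFeasible (fun A => W (P.shorLoop A)) (fun A B => Q (P.shorLoop A) (P.shorLoop B).reverse))
    (hlin : ∀ e, P.lin e W Q = 0) : P.obj W ≤ P.bound := by
  have h := hP W Q
  simp only [rhsResolved, hrow, mul_zero, Finset.sum_const_zero, zero_add, hlin, add_zero] at h
  have h1 : 0 ≤ ∑ j, gramPairing (P.gramWord j) (P.gramVec j) W := Finset.sum_nonneg fun j _ => hgram j
  have h2 : 0 ≤ ∑ s, P.shorTermResolved s W Q := Finset.sum_nonneg fun s _ => hshor _ _
  linarith

/-- **The abstract finite-`N` transfer, resolved wiring**: on ANY planar data with rows valid up to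
`ε_r`, Gram blocks `≥ 0`, resolved relaxation terms `≥ 0` and identification rows valid up to `η_e`,
`obj ≤ bound + Σ_r |y_r| ε_r + Σ_e |z_e| η_e` — NO relaxation defect. [folklore] -/
theorem obj_le_of_defects_resolved (hP : P.IsValidResolved) (W : Word d → ℝ) (Q : Word d → Word d → ℝ)
    (ε : Fin P.nR → ℝ) (η : Fin P.nE → ℝ)
    (hrow : ∀ r, |planarRow P.βt (P.rowAxis r) (P.rowWord r) W Q| ≤ ε r)
    (hgram : ∀ j, 0 ≤ gramPairing (P.gramWord j) (P.gramVec j) W)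
    (hshor : ∀ s, 0 ≤ P.shorTermResolved s W Q) (hlin : ∀ e, |P.lin e W Q| ≤ η e) :
    P.obj W ≤ P.bound + ∑ r, |P.rowMult r| * ε r + ∑ e, |P.linMult e| * η e := by
  have h := hP W Q
  simp only [rhsResolved] at h
  have h1 : 0 ≤ ∑ j, gramPairing (P.gramWord j) (P.gramVec j) W := Finset.sum_nonneg fun j _ => hgram j
  have h2 : 0 ≤ ∑ s, P.shorTermResolved s W Q := Finset.sum_nonneg fun s _ => hshor s
  have h3 : -(∑ r, |P.rowMult r| * ε r) ≤ ∑ r, P.rowMult r * planarRow P.βt (P.rowAxis r) (P.rowWord r) W Q := by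
    rw [← Finset.sum_neg_distrib]
    refine Finset.sum_le_sum fun r _ => ?_
    have := abs_le.1 ((abs_mul _ _).le.trans (mul_le_mul_of_nonneg_left (hrow r) (abs_nonneg (P.rowMult r))))
    linarith [this.1]
  have h4 : -(∑ e, |P.linMult e| * η e) ≤ ∑ e, P.linMult e * P.lin e W Q := by
    rw [← Finset.sum_neg_distrib]
    refine Finset.sum_le_sum fun e _ => ?_
    have := abs_le.1 ((abs_mul _ _).le.trans (mul_le_mul_of_nonneg_left (hlin e) (abs_nonneg (P.linMult e))))
    linarith [this.1]
  linarith

/-! ## States on `ℤ^d` -/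

section States

variable {G : Type*} [Group G] [TopologicalSpace G] [IsTopologicalGroup G] [CompactSpace G]
  [MeasurableSpace G] [BorelSpace G] (ρ : G →* Matrix (Fin N) (Fin N) ℂ)

/-- **The resolved relaxation terms of a state's data are `≥ 0`** (relaxation loops closed at `x`; any
compact `G`, continuous `ρ`, probability `μ`). [folklore] -/
theorem shorTermResolved_loopData_nonneg (hρ : Continuous ρ) (μ : Measure (LGConfig d G)) [IsProbabilityMeasure μ]
    (x : Site d) (hS : ∀ A, Word.endpointZd x (P.shorLoop A) = x) (s : Fin P.nS) :
    0 ≤ P.shorTermResolved s (loopW ρ μ x) (loopQ ρ μ x) :=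
  shorPairing_loopData_resolved_nonneg ρ hρ μ x P.shorLoop hS _ _

/-- **On a state's data the orientation row IS twice the planar relaxation defect**:
`orientationRow(Q_μ) = 2 Σ_s E_μ(Σ_A m_{sA} Im t_{ℓ_A})²`. [folklore] -/
theorem orientationRow_loopQ_eq (hρ : Continuous ρ) (μ : Measure (LGConfig d G)) [IsProbabilityMeasure μ]
    (x : Site d) (hS : ∀ A, Word.endpointZd x (P.shorLoop A) = x) :
    P.orientationRow (loopQ ρ μ x) = 2 * ∑ s, P.shorDefect ρ μ x s := by
  rw [orientationRow, Finset.mul_sum]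
  refine Finset.sum_congr rfl fun s _ => ?_
  rw [← P.shorTermResolved_sub_shorTerm s (loopW ρ μ x) (loopQ ρ μ x), shorTermResolved, shorTerm, shorDefect]
  exact shorPairing_loopData_resolved_sub ρ hρ μ x P.shorLoop hS _ _

/-- **The generic state transfer, resolved wiring** (any compact `G`, continuous `ρ`, probability state
on `ℤ^d`): rows valid up to `ε_r`, identification rows up to `η_e` ⇒
`obj(W_μ) ≤ bound + Σ_r |y_r| ε_r + Σ_e |z_e| η_e`. [folklore] -/
theorem obj_loopW_le_resolved (hP : P.IsValidResolved) (hρ : Continuous ρ) (μ : Measure (LGConfig d G)) [IsProbabilityMeasure μ]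
    (x : Site d) (hgram : ∀ j i, Word.endpointZd x (P.gramWord j i) = x) (hS : ∀ A, Word.endpointZd x (P.shorLoop A) = x)
    (ε : Fin P.nR → ℝ) (η : Fin P.nE → ℝ)
    (hrow : ∀ r, |planarRow P.βt (P.rowAxis r) (P.rowWord r) (loopW ρ μ x) (loopQ ρ μ x)| ≤ ε r)
    (hlin : ∀ e, |P.lin e (loopW ρ μ x) (loopQ ρ μ x)| ≤ η e) :
    P.obj (loopW ρ μ x) ≤ P.bound + ∑ r, |P.rowMult r| * ε r + ∑ e, |P.linMult e| * η e :=
  P.obj_le_of_defects_resolved hP _ _ ε η hrow (fun j => gramPairing_loopW_nonneg ρ hρ μ x _ (hgram j) _)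
    (P.shorTermResolved_loopData_nonneg ρ hρ μ x hS) hlin

end States

/-! ## `U(N)`: exact soundness at every `N` -/

/-- ★★★ **AN ORIENTATION-RESOLVED PLANAR CERTIFICATE IS EXACTLY SOUND FOR `U(N)` LATTICE YANG–MILLS AT
EVERY `N`**: for a resolved-valid `P` at 't Hooft coupling `βt = β/N` and every probability Haar-shift
state `μ` of the `U(N)` Wilson action on `ℤ^d` at tree coupling `β` (every DLR state, torus
thermodynamic limit point, Class-B state) whose data satisfies the identification rows — rows, Gram
words and relaxation loops closed at `x` — `obj(W_μ) ≤ bound`.  No defect, no condition, every real `β`.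
[folklore] -/
theorem obj_loopW_le_uN_resolved (hP : P.IsValidResolved) {β : ℝ} (hβ : β / N = P.βt)
    {μ : Measure (LGConfig d (Matrix.unitaryGroup (Fin N) ℂ))} [IsProbabilityMeasure μ]
    (hμ : IsHaarShiftState (unitaryFundamentalRep (Fin N) ℂ) β μ) (x : Site d)
    (hrow : ∀ r, Word.endpointZd x (P.rowWord r) = x) (hgram : ∀ j i, Word.endpointZd x (P.gramWord j i) = x)
    (hS : ∀ A, Word.endpointZd x (P.shorLoop A) = x)
    (hlin : ∀ e, P.lin e (loopW (unitaryFundamentalRep (Fin N) ℂ) μ x) (loopQ (unitaryFundamentalRep (Fin N) ℂ) μ x) = 0) :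
    P.obj (loopW (unitaryFundamentalRep (Fin N) ℂ) μ x) ≤ P.bound := by
  have h := P.obj_loopW_le_resolved (unitaryFundamentalRep (Fin N) ℂ) hP (continuous_unitaryFundamentalRep (Fin N) ℂ) μ x
    hgram hS (fun _ => 0) (fun _ => 0)
    (fun r => by rw [← hβ, planarRow_loopData_uN hμ x (P.rowAxis r) (P.rowWord r) (hrow r), abs_zero])
    (fun e => by rw [hlin e, abs_zero])
  simpa using h

/-- ★★★ **… for every infinite-volume DLR state of `U(N)`** (every real tree coupling `β`, every `d, N`).
[folklore] -/
theorem obj_loopW_le_uN_of_mem_ymGibbsMeasures_resolved (hP : P.IsValidResolved) {β : ℝ} (hβ : β / N = P.βt)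
    {μ : Measure (LGConfig d (Matrix.unitaryGroup (Fin N) ℂ))}
    (hμ : μ ∈ ymGibbsMeasures (d := d) (unitaryFundamentalRep (Fin N) ℂ) β) (x : Site d)
    (hrow : ∀ r, Word.endpointZd x (P.rowWord r) = x) (hgram : ∀ j i, Word.endpointZd x (P.gramWord j i) = x)
    (hS : ∀ A, Word.endpointZd x (P.shorLoop A) = x)
    (hlin : ∀ e, P.lin e (loopW (unitaryFundamentalRep (Fin N) ℂ) μ x) (loopQ (unitaryFundamentalRep (Fin N) ℂ) μ x) = 0) :
    P.obj (loopW (unitaryFundamentalRep (Fin N) ℂ) μ x) ≤ P.bound := by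
  haveI : SecondCountableTopology (Matrix (Fin N) (Fin N) ℂ) :=
    inferInstanceAs (SecondCountableTopology (Fin N → Fin N → ℂ))
  haveI : SecondCountableTopology (Matrix.unitaryGroup (Fin N) ℂ) :=
    Topology.IsEmbedding.subtypeVal.secondCountableTopology
  haveI : IsProbabilityMeasure μ := hμ.1
  exact P.obj_loopW_le_uN_resolved hP hβ (isHaarShiftState_of_mem_ymGibbsMeasures (unitaryFundamentalRep (Fin N) ℂ)
    (continuous_unitaryFundamentalRep (Fin N) ℂ) hμ) x hrow hgram hS hlin

/-- ★★★ **… for every thermodynamic limit point of the `U(N)` torus Wilson states.** [folklore] -/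
theorem obj_loopW_le_uN_of_mem_infiniteVolumeLimitPoints_resolved (hP : P.IsValidResolved) {β : ℝ} (hβ : β / N = P.βt)
    {μ : Measure (LGConfig d (Matrix.unitaryGroup (Fin N) ℂ))}
    (hμ : μ ∈ infiniteVolumeLimitPoints (d := d) (unitaryFundamentalRep (Fin N) ℂ) β) (x : Site d)
    (hrow : ∀ r, Word.endpointZd x (P.rowWord r) = x) (hgram : ∀ j i, Word.endpointZd x (P.gramWord j i) = x)
    (hS : ∀ A, Word.endpointZd x (P.shorLoop A) = x)
    (hlin : ∀ e, P.lin e (loopW (unitaryFundamentalRep (Fin N) ℂ) μ x) (loopQ (unitaryFundamentalRep (Fin N) ℂ) μ x) = 0) :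
    P.obj (loopW (unitaryFundamentalRep (Fin N) ℂ) μ x) ≤ P.bound := by
  haveI : SecondCountableTopology (Matrix (Fin N) (Fin N) ℂ) :=
    inferInstanceAs (SecondCountableTopology (Fin N → Fin N → ℂ))
  haveI : SecondCountableTopology (Matrix.unitaryGroup (Fin N) ℂ) :=
    Topology.IsEmbedding.subtypeVal.secondCountableTopology
  exact P.obj_loopW_le_uN_of_mem_ymGibbsMeasures_resolved hP hβ
    (mem_ymGibbsMeasures_of_mem_infiniteVolumeLimitPoints_holds (unitaryFundamentalRep (Fin N) ℂ)
      (continuous_unitaryFundamentalRep (Fin N) ℂ) hμ) x hrow hgram hS hlin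

/-! ## `SU(N)`: only the row defects remain -/

/-- ★★★ **AN ORIENTATION-RESOLVED PLANAR CERTIFICATE BOUNDS `SU(N)` AT EVERY `N` UP TO THE ROW DEFECTS
ONLY**: `obj(W_μ) ≤ bound + Σ_r |y_r| (length(w_r)/N² + |βt| Σ_{ν,ε} |Γ_μ(w_r, P̃_{ν,ε})|)` for every
probability Haar-shift state of the `SU(N)` Wilson action at tree coupling `β`, `β/N = βt`. [folklore] -/
theorem obj_loopW_le_suN_resolved (hP : P.IsValidResolved) {β : ℝ} (hβ : β / N = P.βt)
    {μ : Measure (LGConfig d (Matrix.specialUnitaryGroup (Fin N) ℂ))} [IsProbabilityMeasure μ]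
    (hμ : IsHaarShiftState (fundamentalRep (Fin N)) β μ) (x : Site d)
    (hrow : ∀ r, Word.endpointZd x (P.rowWord r) = x) (hgram : ∀ j i, Word.endpointZd x (P.gramWord j i) = x)
    (hS : ∀ A, Word.endpointZd x (P.shorLoop A) = x)
    (hlin : ∀ e, P.lin e (loopW (fundamentalRep (Fin N)) μ x) (loopQ (fundamentalRep (Fin N)) μ x) = 0) :
    P.obj (loopW (fundamentalRep (Fin N)) μ x) ≤ P.bound + ∑ r, |P.rowMult r| * P.rowDefectSuN μ x r := by
  have h := P.obj_loopW_le_resolved (fundamentalRep (Fin N)) hP (continuous_fundamentalRep (Fin N)) μ x hgram hS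
    (P.rowDefectSuN μ x) (fun _ => 0)
    (fun r => by
      have h := abs_planarRow_loopData_suN_le hμ x (P.rowAxis r) (P.rowWord r) (hrow r)
      rw [hβ] at h
      exact h)
    (fun e => by rw [hlin e, abs_zero])
  simpa using h

/-- ★★★ **… for every infinite-volume DLR state of `SU(N)`.** [folklore] -/
theorem obj_loopW_le_suN_of_mem_ymGibbsMeasures_resolved (hP : P.IsValidResolved) {β : ℝ} (hβ : β / N = P.βt)
    {μ : Measure (LGConfig d (Matrix.specialUnitaryGroup (Fin N) ℂ))}
    (hμ : μ ∈ ymGibbsMeasures (d := d) (fundamentalRep (Fin N)) β) (x : Site d)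
    (hrow : ∀ r, Word.endpointZd x (P.rowWord r) = x) (hgram : ∀ j i, Word.endpointZd x (P.gramWord j i) = x)
    (hS : ∀ A, Word.endpointZd x (P.shorLoop A) = x)
    (hlin : ∀ e, P.lin e (loopW (fundamentalRep (Fin N)) μ x) (loopQ (fundamentalRep (Fin N)) μ x) = 0) :
    P.obj (loopW (fundamentalRep (Fin N)) μ x) ≤ P.bound + ∑ r, |P.rowMult r| * P.rowDefectSuN μ x r := by
  haveI : SecondCountableTopology (Matrix (Fin N) (Fin N) ℂ) :=
    inferInstanceAs (SecondCountableTopology (Fin N → Fin N → ℂ))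
  haveI : SecondCountableTopology (Matrix.specialUnitaryGroup (Fin N) ℂ) :=
    Topology.IsEmbedding.subtypeVal.secondCountableTopology
  haveI : IsProbabilityMeasure μ := hμ.1
  exact P.obj_loopW_le_suN_resolved hP hβ (isHaarShiftState_of_mem_ymGibbsMeasures (fundamentalRep (Fin N))
    (continuous_fundamentalRep (Fin N)) hμ) x hrow hgram hS hlin

/-- ★★★ **… for every thermodynamic limit point of the `SU(N)` torus Wilson states.** [folklore] -/
theorem obj_loopW_le_suN_of_mem_infiniteVolumeLimitPoints_resolved (hP : P.IsValidResolved) {β : ℝ} (hβ : β / N = P.βt)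
    {μ : Measure (LGConfig d (Matrix.specialUnitaryGroup (Fin N) ℂ))}
    (hμ : μ ∈ infiniteVolumeLimitPoints (d := d) (fundamentalRep (Fin N)) β) (x : Site d)
    (hrow : ∀ r, Word.endpointZd x (P.rowWord r) = x) (hgram : ∀ j i, Word.endpointZd x (P.gramWord j i) = x)
    (hS : ∀ A, Word.endpointZd x (P.shorLoop A) = x)
    (hlin : ∀ e, P.lin e (loopW (fundamentalRep (Fin N)) μ x) (loopQ (fundamentalRep (Fin N)) μ x) = 0) :
    P.obj (loopW (fundamentalRep (Fin N)) μ x) ≤ P.bound + ∑ r, |P.rowMult r| * P.rowDefectSuN μ x r := by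
  haveI : SecondCountableTopology (Matrix (Fin N) (Fin N) ℂ) :=
    inferInstanceAs (SecondCountableTopology (Fin N → Fin N → ℂ))
  haveI : SecondCountableTopology (Matrix.specialUnitaryGroup (Fin N) ℂ) :=
    Topology.IsEmbedding.subtypeVal.secondCountableTopology
  exact P.obj_loopW_le_suN_of_mem_ymGibbsMeasures_resolved hP hβ
    (mem_ymGibbsMeasures_of_mem_infiniteVolumeLimitPoints_holds (fundamentalRep (Fin N))
      (continuous_fundamentalRep (Fin N)) hμ) x hrow hgram hS hlin

end PlanarCertificate

end Summit.QuantumFields.GaugeBoot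

end
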